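import Mathlib
import HarnessLib
import Summits.HubbardSuperconductivity.HubbardSuperconductivity.Theorems.KLProgrammeKLRegimeSplitLegDressing
import Summits.HubbardSuperconductivity.HubbardSuperconductivity.Theorems.KLProgrammeKLRegimeSplitEngineV10
import Summits.HubbardSuperconductivity.HubbardSuperconductivity.Theorems.KLProgrammeKLRegimeSplitThermalLayerExt
import Summits.HubbardSuperconductivity.HubbardSuperconductivity.Theorems.KLProgrammeKLRegimeWickLegDressingModel

/-!
# Route `KLProgramme` — ENGINE child (stmt-HubbardSuperconductivity-19918 / its gen-6 successor on `klPredsV15`), (E2-v10): the LEG-DRESSING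
# term is within `legDressBarQ2 · legSliceCountT` (cell gate-hubbard-kl, seat hubbard-kl-k3c2-p3 g3, row «leg-dress bar»; sequel to
# `…SplitLegDressing` (per-leg sizes `klld_*`), `…SplitEngineV10` (T2: `legDressBarQ2`, p504421) and p1 g9's `…WickLegDressingModel`
# (`vertexFn_dblFold_oneLine`, the one-line term EXACTLY))

The one-line (`j = 1`) term of the scale step at four external legs `Z` is, exactly (p1 g9, `vertexFn_dblFold_oneLine`),
`2·(βL²)⁻¹ · 𝒱₄(𝒲)(Z) · Σ_{i<4} ℓ(p_i)·Σ(p_i,σ_i)` — value × Σ over legs of (line value × self-energy).  This file supplies the three size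
steps that turn it into the (E2-v10) budget term `legDressBarQ2 G P Q U n (legSliceCountT … n legs)` of `PairLadderStepAtV10` & co.:
* §1 ARITHMETIC: in the engine's range `n ≤ n_β + 1` (`π/β ≤ 4Λ_n`, `klte_pi_div_le_four_mul_klScale`) the per-leg bracket of
  `klld_leg_dressing_le` is `≤ (64·cr + 32·cz)·|U|` (`klld_bracket_le`), and `2·v·((64cr+32cz)|U|)·c ≤ legDressBarQ2 G P Q U n c` as soon as
  `v ≤ Klam·|U|` and `128·cr + 64·cz ≤ Q.CR·Klam` (`legDress_size_le_legDressBarQ2`) — the ONE inequality on `Q.CR` the registrant's package must meet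
  for this term (`Q` is chosen after `R`: order sound);
* §2 PLAIN carriers: with the history slots (E0)/`RenormalisedAtF R (n−1)`/`TwoLegSlopes R (n−1)` of `klld_sum_leg_dressing_le`,
  `(βL²)⁻¹·2·v·Σ_i ‖slice entry_i‖·‖Σ_{n−1}(ω₀,k_i,σ_i)‖ ≤ legDressBarQ2 G P Q U n (legSliceCountT … n k)` (`klld_legDress_le_legDressBarQ2`);
* §3 WICK carriers (norm form of p1's identity): `‖𝒱₄(dblFold(Δ_×(C)(𝒲_n⁰𝒲_n¹)))(Z)‖ ≤ 2(βL²)⁻¹‖𝒱₄(𝒲_n)(Z)‖·Σ_i ‖ℓ(p_i)‖·‖Σ^W_n(p_i,σ_i)‖`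
  (`norm_vertexFn_dblFold_oneLine_le`) and, when every leg's `‖ℓ(p_i)‖·‖Σ^W_n(p_i,σ_i)‖ ≤ βL²·s` and `ℓ(p_i) = 0` off a set `S` of legs,
  `≤ 2·‖𝒱₄(𝒲_n)(Z)‖·s·#S` (`norm_vertexFn_dblFold_oneLine_le_of_count`) — the shape §1 converts.
Which self-energy control feeds `s` on the Wick side ((B) of the cell's roadmap) is not decided here; nothing about the model beyond the cited
identities is asserted.  Proved; no definitions.
-/

noncomputable section

namespace Summit.HubbardSuperconductivity.HubbardSuperconductivity.Theorems.KLRegimeSplit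

set_option linter.dupNamespace false -- summit = problem name (single-conjunct summit), D-0017

open Real Finset Literature.MathematicalPhysics.QuantumLattice Literature.Probability.LatticeModels
open Summit.HubbardSuperconductivity.HubbardSuperconductivity.Theorems.KLProgrammeLegKernels
open Summit.HubbardSuperconductivity.HubbardSuperconductivity.Theorems.KLRegimeWick

/-! ## §1 Arithmetic: the per-leg bracket in the engine's range, and the `Q.CR` threshold -/

/-- In the engine's range `n ≤ n_β + 1` the per-leg bracket of `klld_leg_dressing_le` is at most `(64·cr + 32·cz)·|U|`
(`4^{-n} ≤ 1`, `(π/β)/Λ_n ≤ 4`). -/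
theorem klld_bracket_le {β U : ℝ} (hβ : klBetaMin ≤ β) {R : RenConsts} (hcr : 0 ≤ R.cr) (hcz : 0 ≤ R.cz) {n : ℕ}
    (hn : n ≤ nScales β + 1) :
    64 * R.cr * |U| * ((4 : ℝ) ^ n)⁻¹ + 16 * R.cz * |U| + 4 * R.cz * |U| * ((Real.pi / β) / klScale klE0 n) ≤
      (64 * R.cr + 32 * R.cz) * |U| := by
  have hΛ := klth_klScale_pos n
  have hU := abs_nonneg U
  have h4 : ((4 : ℝ) ^ n)⁻¹ ≤ 1 := inv_le_one_of_one_le₀ (one_le_pow₀ (by norm_num))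
  have hr : (Real.pi / β) / klScale klE0 n ≤ 4 := by
    rw [div_le_iff₀ hΛ]
    exact klte_pi_div_le_four_mul_klScale hβ hn
  have h1 : 64 * R.cr * |U| * ((4 : ℝ) ^ n)⁻¹ ≤ 64 * R.cr * |U| * 1 := mul_le_mul_of_nonneg_left h4 (by positivity)
  have h2 : 4 * R.cz * |U| * ((Real.pi / β) / klScale klE0 n) ≤ 4 * R.cz * |U| * 4 := mul_le_mul_of_nonneg_left hr (by positivity)
  nlinarith

/-- **The `Q.CR` threshold.**  If the value is `≤ Klam·|U|` and `128·cr + 64·cz ≤ Q.CR·Klam` (`Q.CR, Klam, cr, cz ≥ 0`), then for every count `c`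
`2·v·((64cr + 32cz)|U|)·c ≤ legDressBarQ2 G P Q U n c` (`= Q.CR·((Klam U)² + (Klam|U|)³)·c ≥ Q.CR·Klam²·U²·c`). -/
theorem legDress_size_le_legDressBarQ2 (G : GeoConsts) {P : SplitConsts} {Q : EngConsts} {R : RenConsts} (hK : 0 ≤ P.Klam)
    (hQ0 : 0 ≤ Q.CR) (hcr : 0 ≤ R.cr) (hcz : 0 ≤ R.cz) (hCR : 128 * R.cr + 64 * R.cz ≤ Q.CR * P.Klam) (U : ℝ) (n : ℕ) {v : ℝ}
    (hv : v ≤ P.Klam * |U|) (c : ℕ) :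
    2 * v * ((64 * R.cr + 32 * R.cz) * |U|) * (c : ℝ) ≤ legDressBarQ2 G P Q U n c := by
  rw [legDressBarQ2_eq]
  have hU := abs_nonneg U
  have hc : (0 : ℝ) ≤ c := Nat.cast_nonneg c
  have hKU : 0 ≤ P.Klam * |U| := mul_nonneg hK hU
  have h3 : 0 ≤ (P.Klam * |U|) ^ 3 := pow_nonneg hKU 3
  have hsq : (P.Klam * U) ^ 2 = (P.Klam * |U|) ^ 2 := by rw [mul_pow, mul_pow, sq_abs]
  rw [hsq]
  -- `2 v (64cr+32cz)|U| ≤ 2 (Klam|U|) (64cr+32cz) |U| = (128cr+64cz)·Klam·|U|² ≤ Q.CR·Klam²·|U|²`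
  have h1 : 2 * v * ((64 * R.cr + 32 * R.cz) * |U|) ≤ 2 * (P.Klam * |U|) * ((64 * R.cr + 32 * R.cz) * |U|) :=
    mul_le_mul_of_nonneg_right (mul_le_mul_of_nonneg_left hv (by norm_num)) (by positivity)
  have h2 : 2 * (P.Klam * |U|) * ((64 * R.cr + 32 * R.cz) * |U|) = (128 * R.cr + 64 * R.cz) * P.Klam * |U| ^ 2 := by ring
  have h4 : (128 * R.cr + 64 * R.cz) * P.Klam * |U| ^ 2 ≤ Q.CR * P.Klam * P.Klam * |U| ^ 2 :=
    mul_le_mul_of_nonneg_right (mul_le_mul_of_nonneg_right hCR hK) (sq_nonneg _)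
  calc 2 * v * ((64 * R.cr + 32 * R.cz) * |U|) * (c : ℝ)
      ≤ Q.CR * P.Klam * P.Klam * |U| ^ 2 * (c : ℝ) := mul_le_mul_of_nonneg_right (h1.trans (h2.le.trans h4)) hc
    _ = Q.CR * ((P.Klam * |U|) ^ 2) * (c : ℝ) := by ring
    _ ≤ Q.CR * ((P.Klam * |U|) ^ 2 + (P.Klam * |U|) ^ 3) * (c : ℝ) := by
        nlinarith [mul_nonneg (mul_nonneg hQ0 h3) hc]

/-! ## §2 Plain carriers: the summed per-leg sizes of `…SplitLegDressing` are within `legDressBarQ2 · legSliceCountT` -/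

section Plain

variable {L M : ℕ} [NeZero L] [NeZero M]

/-- **`klld_legDress_le_legDressBarQ2`** — at step `n`, `1 ≤ n ≤ n_β + 1`, under the history slots of `klld_sum_leg_dressing_le` and the threshold
`128·cr + 64·cz ≤ Q.CR·Klam`: for any value `v ≤ Klam·|U|` and any four legs `k` (spins `σ`, charge labels `c, c'`),
`(βL²)⁻¹ · (2·v · Σ_i ‖slice entry_i‖·‖Σ_{n−1}(ω₀,k_i,σ_i)‖) ≤ legDressBarQ2 G P Q U n (legSliceCountT … n k)`. -/
theorem klld_legDress_le_legDressBarQ2 {β U μ : ℝ} (hβ : klBetaMin ≤ β) {K : TrigPolyC4v} {R : RenConsts} (hcr : 0 ≤ R.cr) (hcz : 0 ≤ R.cz)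
    {n : ℕ} (hn1 : 1 ≤ n) (hn : n ≤ nScales β + 1) (hE0 : SelfEnergySymmetric L M β U μ K (n - 1))
    (hren : RenormalisedAtF L M β U μ K R (n - 1)) (hsl : TwoLegSlopes L M R β U μ K (n - 1))
    (G : GeoConsts) {P : SplitConsts} {Q : EngConsts} (hK : 0 ≤ P.Klam) (hQ0 : 0 ≤ Q.CR) (hCR : 128 * R.cr + 64 * R.cz ≤ Q.CR * P.Klam)
    {v : ℝ} (hv0 : 0 ≤ v) (hv : v ≤ P.Klam * |U|) (k : Fin 4 → TorusSite 2 L) (σ c c' : Fin 4 → Fin 2) :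
    (β * (L : ℝ) ^ 2)⁻¹ * (2 * v *
        ∑ i : Fin 4, ‖hubbardCovSliceCT L M β μ 0 K (klScale klE0 n) (klScale klE0 (n - 1)) (((omega0 M, k i), σ i), c i)
            (((omega0 M, k i), σ i), c' i)‖ * ‖klSelfEnergy L M β U μ K klE0 (n - 1) (omega0 M, k i) (σ i)‖) ≤
      legDressBarQ2 G P Q U n (legSliceCountT L β μ K n k) := by
  have hβ0 : 0 < β := pos_of_klBetaMin_le hβ
  have hL : (0 : ℝ) < (L : ℝ) := Nat.cast_pos.2 (Nat.pos_of_ne_zero (NeZero.ne L))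
  have hβL : 0 < β * (L : ℝ) ^ 2 := by positivity
  have hS := klld_sum_leg_dressing_le (L := L) (M := M) (μ := μ) hβ0 hcr hcz hn1 hE0 hren hsl k σ c c'
  have hbr := klld_bracket_le (U := U) hβ hcr hcz hn
  have hcnt : (0 : ℝ) ≤ (legSliceCountT L β μ K n k : ℝ) := Nat.cast_nonneg _
  have hfin := legDress_size_le_legDressBarQ2 G hK hQ0 hcr hcz hCR U n hv (legSliceCountT L β μ K n k)
  -- `(βL²)⁻¹ · 2v · S ≤ 2v · bracket · count ≤ 2v · (64cr+32cz)|U| · count ≤ legDressBarQ2`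
  have h1 : (β * (L : ℝ) ^ 2)⁻¹ * (2 * v * ∑ i : Fin 4,
      ‖hubbardCovSliceCT L M β μ 0 K (klScale klE0 n) (klScale klE0 (n - 1)) (((omega0 M, k i), σ i), c i)
          (((omega0 M, k i), σ i), c' i)‖ * ‖klSelfEnergy L M β U μ K klE0 (n - 1) (omega0 M, k i) (σ i)‖) ≤
      (β * (L : ℝ) ^ 2)⁻¹ * (2 * v * (β * (L : ℝ) ^ 2 *
          (64 * R.cr * |U| * ((4 : ℝ) ^ n)⁻¹ + 16 * R.cz * |U| + 4 * R.cz * |U| * ((Real.pi / β) / klScale klE0 n)) *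
        (legSliceCountT L β μ K n k : ℝ))) :=
    mul_le_mul_of_nonneg_left (mul_le_mul_of_nonneg_left hS (by positivity)) (inv_pos.2 hβL).le
  refine h1.trans ?_
  rw [show (β * (L : ℝ) ^ 2)⁻¹ * (2 * v * (β * (L : ℝ) ^ 2 *
          (64 * R.cr * |U| * ((4 : ℝ) ^ n)⁻¹ + 16 * R.cz * |U| + 4 * R.cz * |U| * ((Real.pi / β) / klScale klE0 n)) *
        (legSliceCountT L β μ K n k : ℝ))) =
      2 * v * (64 * R.cr * |U| * ((4 : ℝ) ^ n)⁻¹ + 16 * R.cz * |U| + 4 * R.cz * |U| * ((Real.pi / β) / klScale klE0 n)) *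
        (legSliceCountT L β μ K n k : ℝ) by field_simp]
  calc 2 * v * (64 * R.cr * |U| * ((4 : ℝ) ^ n)⁻¹ + 16 * R.cz * |U| + 4 * R.cz * |U| * ((Real.pi / β) / klScale klE0 n)) *
        (legSliceCountT L β μ K n k : ℝ)
      ≤ 2 * v * ((64 * R.cr + 32 * R.cz) * |U|) * (legSliceCountT L β μ K n k : ℝ) :=
        mul_le_mul_of_nonneg_right (mul_le_mul_of_nonneg_left hbr (by positivity)) hcnt
    _ ≤ legDressBarQ2 G P Q U n (legSliceCountT L β μ K n k) := hfin

end Plain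

/-! ## §3 Wick carriers: the norm form of `vertexFn_dblFold_oneLine` and its counted form -/

section Wick

open GrassmannAlgebra Matrix
open Summit.HubbardSuperconductivity.HubbardSuperconductivity.Theorems.TwoPointAssembly

variable {L M : ℕ} [NeZero L] [NeZero M]

/-- **Norm form of the exact leg-dressing identity**: for the Wick action `𝒲_n`, a diagonal line `C` (values `ℓ`) and ANY four external legs,
`‖𝒱₄(dblFold(Δ_×(C)(𝒲_n⁰𝒲_n¹)))(Z)‖ ≤ 2·(βL²)⁻¹·‖𝒱₄(𝒲_n)(Z)‖·Σ_{i<4} ‖ℓ(p_i)‖·‖Σ^W_n(p_i,σ_i)‖`. -/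
theorem norm_vertexFn_dblFold_oneLine_le {β : ℝ} (hβ : 0 < β) (U μ : ℝ) (K : TrigPolyC4v)
    {C : Matrix (HubbardFieldIdx L M) (HubbardFieldIdx L M) ℂ} {ℓ : FreqMomentum L M → ℂ} (hC : contr ℂ C = diagContr L M ℓ) (n : ℕ)
    (Z : Fin 4 → HubbardFieldIdx L M) :
    ‖vertexFn L M β (dblFold ℂ (grassmannLaplacian ℂ (crossCov ℂ C)
        (dblCopy ℂ 0 (klWickAction L M β U μ K n) * dblCopy ℂ 1 (klWickAction L M β U μ K n)))) 4 Z‖ ≤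
      2 * (β * (L : ℝ) ^ 2)⁻¹ * ‖vertexFn L M β (klWickAction L M β U μ K n) 4 Z‖ *
        ∑ i : Fin 4, ‖ℓ (Z i).1.1‖ * ‖klWickSelfEnergy L M β U μ K n (Z i).1.1 (Z i).1.2‖ := by
  have hL : (0 : ℝ) < (L : ℝ) := Nat.cast_pos.2 (Nat.pos_of_ne_zero (NeZero.ne L))
  have hβL : 0 < β * (L : ℝ) ^ 2 := by positivity
  rw [vertexFn_dblFold_oneLine β U μ K hβ.ne' hC n Z, norm_mul, norm_mul, norm_mul, norm_inv, Complex.norm_real,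
    Real.norm_of_nonneg hβL.le, Complex.norm_ofNat]
  refine mul_le_mul_of_nonneg_left ((norm_sum_le _ _).trans (le_of_eq ?_)) (by positivity)
  refine Finset.sum_congr rfl fun i _ => ?_
  rw [norm_mul]

/-- **Counted form**: if `ℓ` vanishes at every leg outside a set `S` and `‖ℓ(p_i)‖·‖Σ^W_n(p_i,σ_i)‖ ≤ βL²·s` on `S` (`s ≥ 0`), then
`‖𝒱₄(dblFold(Δ_×(C)(𝒲_n⁰𝒲_n¹)))(Z)‖ ≤ 2·‖𝒱₄(𝒲_n)(Z)‖·s·#S` — the shape `legDress_size_le_legDressBarQ2` converts into the (E2-v10) budget term. -/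
theorem norm_vertexFn_dblFold_oneLine_le_of_count {β : ℝ} (hβ : 0 < β) (U μ : ℝ) (K : TrigPolyC4v)
    {C : Matrix (HubbardFieldIdx L M) (HubbardFieldIdx L M) ℂ} {ℓ : FreqMomentum L M → ℂ} (hC : contr ℂ C = diagContr L M ℓ) (n : ℕ)
    (Z : Fin 4 → HubbardFieldIdx L M) {s : ℝ} (hs0 : 0 ≤ s) (S : Finset (Fin 4)) (hS : ∀ i, i ∉ S → ℓ (Z i).1.1 = 0)
    (hs : ∀ i ∈ S, ‖ℓ (Z i).1.1‖ * ‖klWickSelfEnergy L M β U μ K n (Z i).1.1 (Z i).1.2‖ ≤ β * (L : ℝ) ^ 2 * s) :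
    ‖vertexFn L M β (dblFold ℂ (grassmannLaplacian ℂ (crossCov ℂ C)
        (dblCopy ℂ 0 (klWickAction L M β U μ K n) * dblCopy ℂ 1 (klWickAction L M β U μ K n)))) 4 Z‖ ≤
      2 * ‖vertexFn L M β (klWickAction L M β U μ K n) 4 Z‖ * s * (S.card : ℝ) := by
  have hL : (0 : ℝ) < (L : ℝ) := Nat.cast_pos.2 (Nat.pos_of_ne_zero (NeZero.ne L))
  have hβL : 0 < β * (L : ℝ) ^ 2 := by positivity
  refine (norm_vertexFn_dblFold_oneLine_le hβ U μ K hC n Z).trans ?_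
  -- the leg sum is `≤ βL²·s·#S`
  have hsum : ∑ i : Fin 4, ‖ℓ (Z i).1.1‖ * ‖klWickSelfEnergy L M β U μ K n (Z i).1.1 (Z i).1.2‖ ≤ β * (L : ℝ) ^ 2 * s * (S.card : ℝ) := by
    have hz : 0 ≤ β * (L : ℝ) ^ 2 * s := by positivity
    refine klld_sum_le_mul_of_card_le (p := fun i => i ∈ S) (inst := inferInstance) hz
      (fun i hi => by rw [hS i hi, norm_zero, zero_mul]) (fun i => ?_) (le_of_eq ?_)
    · by_cases hi : i ∈ S
      · exact hs i hi
      · rw [hS i hi, norm_zero, zero_mul]; exact hz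
    · rw [Finset.filter_mem_eq_inter, Finset.univ_inter]
  calc 2 * (β * (L : ℝ) ^ 2)⁻¹ * ‖vertexFn L M β (klWickAction L M β U μ K n) 4 Z‖ *
        ∑ i : Fin 4, ‖ℓ (Z i).1.1‖ * ‖klWickSelfEnergy L M β U μ K n (Z i).1.1 (Z i).1.2‖
      ≤ 2 * (β * (L : ℝ) ^ 2)⁻¹ * ‖vertexFn L M β (klWickAction L M β U μ K n) 4 Z‖ * (β * (L : ℝ) ^ 2 * s * (S.card : ℝ)) :=
        mul_le_mul_of_nonneg_left hsum (by positivity)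
    _ = 2 * ‖vertexFn L M β (klWickAction L M β U μ K n) 4 Z‖ * s * (S.card : ℝ) := by field_simp

end Wick

end Summit.HubbardSuperconductivity.HubbardSuperconductivity.Theorems.KLRegimeSplit

end
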